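import Summits.AtomisticToContinuum.Crystallization.Theses.FreeSplittingCertificates
import Summits.AtomisticToContinuum.Crystallization.Theorems.FreeSplittingCertificatesStrictSplittingRuleDefs
import Summits.AtomisticToContinuum.Crystallization.Theorems.FreeSplittingCertificatesStrictSplittingRuleDeficitBound
import Summits.AtomisticToContinuum.Crystallization.Theorems.FreeSplittingCertificatesStrictSplittingRuleHcpFamilyMinExists
import Summits.AtomisticToContinuum.Crystallization.Theorems.FreeSplittingCertificatesStrictSplittingRuleHcpFamilyMinLocalised
import Summits.AtomisticToContinuum.Crystallization.Theorems.FreeSplittingCertificatesStrictSplittingRulePerturbativeReduction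
import Summits.AtomisticToContinuum.Crystallization.Theorems.FreeSplittingCertificatesStrictSplittingRuleCoreDefs
import Summits.AtomisticToContinuum.Crystallization.Theorems.FreeSplittingCertificatesStrictSplittingRuleCoreDefsStar
import Summits.AtomisticToContinuum.Crystallization.Theorems.FreeSplittingCertificatesStrictSplittingRuleCoreFirstOrderDesign
import Summits.AtomisticToContinuum.Crystallization.Theorems.FreeSplittingCertificatesStrictSplittingRuleCoreStarSite
import Summits.AtomisticToContinuum.Crystallization.Theorems.FreeSplittingCertificatesStrictSplittingRuleCoreJointDefs

/-!
# Skeleton for crux `FreeSplittingCertificates.StrictSplittingRule` — line `registered` (birth), reshape r4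
(item stmt-AtomisticToContinuum-12560 · route route-AtomisticToContinuum-FreeSplittingCertificates ·
planner birth 2026-08-17; leads 0, c3 (r1–r3), c4 (r4))

Crux (FIXED, by name; packaged definitionally as `strictSplittingRule_iff`):
for every hard core `δ > 0` there are a radius `R > 0`, a pair-splitting rule `Φ` (box +
complementarity), an in-layer spacing `a > 0` and a c-axis stretch `|t| ≤ 1/100` such that `Φ` is
FEASIBLE on `δ`-separated finite configurations (every weighted site energy `≥ e_∞`) and STRICT toward
the stretched hcp shell `S(a,t)` (for every `η > 0` some `c > 0`: weighted site energy `< e_∞ + c`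
forces the recentred first shell, radius `5a/4`, to be `η`-close to `S(a,t)` up to `O(3)`).

## The line: TWO-TOLERANCE SANDWICH BY CONVEX MIXING OF RULES (regime decomposition in the tolerance)

The rule class (box + complementarity) is CONVEX and the weighted site energy is AFFINE in the rule
(`siteE_mix`).  Hence a feasible rule `Φ₁` that is merely GAPPED at ONE coarse tolerance `η₀`
("every site is `η₀`-near-hcp or pays `c₀ > 0`" — the gross-defect / polytype-selection regime) and
a rule `Φ₂` that is only a PERTURBATIVE certificate (non-negative slack and strictness at `η₀`-good
sites, an arbitrary bounded deficit `D` at bad sites — the phonon / quadratic-coercivity regime, with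
NO global feasibility asked) combine into `Φ := (1-λ)Φ₁ + λΦ₂`, `λ := c₀ / (2(c₀+D))`, which is
feasible (bad sites keep margin `c₀/2`) and strict at every tolerance (`c(η) := min(c₀/2, λ·c₂(η))`).
The two regimes must aim at the SAME shell, so the lattice parameters are pinned RULE-FREE by
`HcpFamilyMin a h` (global minimality of `hcp(a,h)` inside the two-parameter hcp family), with
`h = (1+t)·a·√(2/3)`.  The SHARED CONSTANT of the two regimes is the tolerance fraction `1/N₀`
(`η₀ ≤ a/N₀`): the composition below is generic in `N₀`; the registered stubs instantiate `N₀ = 100`.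

History.  r1 (c3): S0 = S0a + S0b, S2 = S2a + S2b, anchor `stub_defs` (Defs p146333).  r2 (c3): S2b =
reduction (p151592) ∘ `PerturbativeCore`.  r3 (c3): core = `stub_perturbativeCoreOfPieces` (p154347) ∘
(H1 `stub_coreFirstOrderDesign` LANDED p158539, H2 `stub_coreSitewiseHarmonic`, H3 `stub_coreAssembly`); H3
found MISSTATED (wave 3).  LANDED so far (all `--supports` 12560): Defs (+append), DeficitBound S2a p148276,
HcpFamilyMinExists S0a p150114, HcpFamilyMinLocalised S0b p151548, PerturbativeReduction p151592, CoreDefs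
p154347 (+r4 appends p161758, p162107), CoreHall p154502, H1 p158539 (+Geometry p157345, Truss p158042),
LargeCore p153081, CoarseGapLadder p153831 (S1 ⇒ crux r2), Negative/CentrosymmetricShell p152738 and
Negative/FalseOfBravaisGroundState p153502 (S ⇒ uniform Bravais gap), HcpShapeKernel2 p150501.

RESHAPE r4 (lead c4, 2026-08-17; evidence ASSEMBLY-ARCHITECTURE.md, SOS-NUMERICS.md on the item):
* H2 → H2⋆ `stub_coreStarCoercive : … → CoreStarCoercive a h κ₁ κ₃` with EXPLICIT constants (CoreDefsStar): one
  covariant decaying transfer family makes the sitewise second variation dominate `κ₁·Σ_shell stretch²` (radial;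
  `κ_glob = 1.932`) `+ κ₃·` the squared distance of the RECENTRED first-shell displacement from the infinitesimal
  rotations (the linearisation of `ShellCloseTo`; `κ_glob = 0.263`) — instead of r3's radial-only norm (no
  strictness: the 13-site shell framework flexes) with an existential `κ` (no fixed tolerance).  Two constants
  because the cubic remainder is mostly a STRETCH quantity (`≤ (18.8ρ+106ρ²)Σx² + (1.41ρ+0.73ρ²)Σy²` at shell
  residual `ρ`), absorbed by the stiff radial coercivity, while strictness needs the soft rotation norm; r3's
  `stub_coreSitewiseHarmonic` is a COROLLARY (`coreSitewiseHarmonic_of_star`).  `κ_site` is pinned by the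
  sitewise-SOS semidefinite programme (stationary-field duality: `κ_site ≤ κ_glob`; necessarily
  `κ₁/1.932 + κ₃/0.263 ≤ 1`).
* H3 → H3⋆ `stub_coreStarAssembly : ∀ a h, CoreStarAssembly κ₁ κ₃ N₀ a h` (quantitative; XL, item-sized: rule
  `½ + θ` with equivariantly averaged near-field design and geometric far-field design, charts of
  two-shell-good regions, cubic remainders charged to `κ₁` (stretch part) and `κ₃` (transverse part), excluded
  bad layers dominating discreteness/truncation residuals).
* core = registered anchor `stub_perturbativeCoreOfStarPieces κ₁ κ₃ N₀` (CoreDefsStar, proved) ∘ (H1, H2⋆, H3⋆);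
  S2b from the core at fraction `1/N₀` via the landed generic `perturbative_certificate_of_core`.
  Constants `(κ₁, κ₃, N₀) = (1/3, 1/12, 100)` (49 % of the global budget; need at `a/100`: `κ₁a² ≥ 0.258`,
  `κ₃ ≥ 0.018`), CONFIRMED by the sitewise-SOS SDP (SOS-NUMERICS.md §5: κ_site/κ_glob = 0.81–0.98 rising with the
  test space, no duality gap; combined feasibility factor ≥ 1.73 > the 1.43 certification margin).
* S1 `stub_coarseGapCertificate` UNCHANGED and PROMOTED (c3: it contains crux r2 `FiniteRangeSplitting`
  verbatim plus one-tolerance polytype selection; `stub_coarseGapGivesR2` p153831) — kept registered as the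
  line's record of what the coarse regime owes; no worker.

Registered stubs after r4 (sorries ONLY here): `stub_coarseGapCertificate` (S1, promoted),
`stub_coreStarCoercive` (H2⋆), `stub_coreStarAssembly` (H3⋆).

RESHAPE r5 (lead c5, 2026-08-17; evidence FAR-FIELD-ANALYSIS.md, NOTES.md on the item / crux dir):
* H2⋆ → H2⋆cert `stub_coreStarTwoSiteCert`: the SAME constants (1/3, 1/12), but the registered obligation is now exactly
  what a certificate proves — one covariant decaying table and the sitewise inequality `CoreStarSiteIneq` (landed
  …CoreStarSite.lean p172227, definitionally the body of `CoreStarCoercive`) at the TWO sublattice representatives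
  `(0,0,0)`, `(1,0,0)` for every finitely supported `u`; `stub_coreStarCoercive` is DERIVED via the landed Bravais-covariance
  reduction `stub_coreStarTwoSites` (two sites ⇒ all sites).  Why: (i) every finite (torus / interval-arithmetic)
  certificate has this shape; (ii) the near-field-LMI + longitudinal-Korn plan of r4 is invalid — the truncated bare form
  is negative on linearised rotations cut off at any radius (prestress: first-shell struts vs far cables, zero total
  stress), so the far field must be carried INSIDE one covariant table (isotropic r⁻⁷…r⁻⁶ imports) and the exact finite
  model is the torus, not a Dirichlet ball (FAR-FIELD-ANALYSIS.md §1–2); torus numerics (§3): κ-demand at λ = 1 not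
  binding, residual margins −2.4e-4 (6×6×3) explained as (L/2)⁻⁸ range artifacts.
* Landed r5 helpers (all --supports 12560): stub_finiteBall p171721, stub_farPairLowerBound p171710, stub_summableTransfer
  p171731, stub_summableBareSecondVariation p171741, stub_prestressFormVanishes p172094, stub_ljSqTaylor p172153,
  CoreStarSite (def CoreStarSiteIneq, coreStarCoercive_iff_site, coreStarSiteIneq_translate, stub_coreStarTwoSites) p172227.
Registered stubs after r5 (sorries ONLY here): `stub_coarseGapCertificate` (S1, promoted), `stub_coreStarTwoSiteCert`
(H2⋆cert), `stub_coreStarAssembly` (H3⋆).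

RESHAPE r6 (lead c5, 2026-08-17, same cycle; evidence H3-SCOPE.md (wave-2 worker: stub-misstated stub_coreStarAssembly),
FAR-FIELD-ANALYSIS.md §4, CoreJointDefs.lean):  "H1 ∧ H2⋆ ⇒ core" is NOT assemblable for any constants — the rule's
first-order transfers act on rotation-invariant readouts `ẽ = dl + ½‖Δu‖²`, so H1 (an identity in `dl`) leaves the signed
READOUT FORM of `β` in every second-order ledger (witness −0.0398δ² at a zero-norm site), and the κ₃-charge needs p's own
least-squares co-rotated chart.  New split of the core: H12⋆ `stub_coreJointCoercive` (JOINT certificate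
`CoreJointCoercive a h (1/3) (1/12)`: H1's identity for `β` AND the co-rotated sitewise second-order inequality with the
readout form of `β` on the demand side, `CoreJointSiteIneq`) and H3′ `stub_coreJointAssembly` (`CoreJointAssembly (1/3)
(1/12) 100 a h`), composed by the landed anchor `stub_perturbativeCoreOfJointPieces`.  H1 is the projection of H12⋆
(`coreFirstOrderDesign_of_joint`); r5's H2⋆cert / H3⋆ leave the skeleton (H2⋆ stays a consequence-free side statement;
NB the polytype line's `PolytypeCoreAssembly` consumes `CoreStarCoercive` and inherits the same defect — flagged on the
item).  Constants (1/3, 1/12, 100) kept: H3-SCOPE Q1 (sharp cubic remainder uses 52 % of them at ρ = 1/100; N₀ ≥ 66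
would do) and the torus numerics of the joint LMI (NOTES.md; jobs j027907/j027933) decide; the composition is generic.
Registered stubs after r6 (sorries ONLY here): `stub_coarseGapCertificate` (S1, promoted), `stub_coreJointCoercive`
(H12⋆), `stub_coreJointAssembly` (H3′).
Composition `StrictSplittingRule_of N₀ : S0 → S1(N₀) → S2(N₀) → StrictSplittingRule` is sorry-free (convex
mixing), concluding the route decl BY NAME; `strictSplittingRule_of_stubs` instantiates it.

Disproof used: none on file (`ledger crux ls`, 2026-08-17: no `Disproof.lean` for this crux).
Refuter evidence honoured: ANALYSIS.md / lattice_check.out (2026-08-15): necessary `c(η) ≤ e_fcc − e_hcp ≈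
7.25e−5` — consistent (all gap constants existential); relaxed hcp `|t*| ≈ 1.4e−4 ≪ 1/100` (S0 closed).
-/

noncomputable section

namespace Summit.AtomisticToContinuum.Crystallization.Theorems.StrictSplittingRuleBirth

open scoped BigOperators Topology Manifold Classical MeasureTheory ProbabilityTheory Matrix InnerProductSpace ComplexConjugate ContinuousMap
open Filter Set Function TopologicalSpace MeasureTheory
open Literature.MathematicalPhysics.StatisticalMechanics
open Literature.Geometry.DiscreteGeometry
open Summit.AtomisticToContinuum.Crystallization.Theorems.PalmUnimodularRigidity.LayeredLawsSelectHcp (hcpSite)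

/-- Euclidean `3`-space. -/
local notation "E3" => EuclideanSpace ℝ (Fin 3)

/-! ## Vocabulary: `Theorems/FreeSplittingCertificatesStrictSplittingRuleDefs.lean` (`eInf IsRule Sep siteE shell
target Feasible Strict strictSplittingRule_iff HcpFamilyMin mix isRule_mix siteE_mix`, `patternShell GoodAt
compositeRule bondPattern goodSum PerturbativeCore stub_coreMono`) and `…CoreDefs.lean` (`CoreFirstOrderDesign`,
r4: `CoreShellCoercive`, …) and `…CoreDefsStar.lean` (`CoreStarCoercive`, `CoreStarAssembly`,
`stub_perturbativeCoreOfStarPieces`). -/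

/-! ## S0 (CLOSED: S0a p150114, S0b p151548) -/

/-- S0 recomposed from S0a + S0b (`t := h/(a√(2/3)) − 1`). -/
theorem hcpFamilyMinimiser_of
    (h0a : ∃ a h : ℝ, 0 < a ∧ 0 < h ∧ HcpFamilyMin a h)
    (h0b : ∀ a h : ℝ, 0 < a → 0 < h → HcpFamilyMin a h → |h / (a * Real.sqrt (2 / 3)) - 1| ≤ 1 / 100) :
    ∃ a h t : ℝ, 0 < a ∧ |t| ≤ 1 / 100 ∧ h = (1 + t) * a * Real.sqrt (2 / 3) ∧ HcpFamilyMin a h := by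
  obtain ⟨a, h, ha, hh, hmin⟩ := h0a
  have hs : 0 < Real.sqrt (2 / 3) := Real.sqrt_pos.mpr (by norm_num)
  have has : a * Real.sqrt (2 / 3) ≠ 0 := (mul_pos ha hs).ne'
  refine ⟨a, h, h / (a * Real.sqrt (2 / 3)) - 1, ha, h0b a h ha hh hmin, ?_, hmin⟩
  field_simp
  ring

/-! ## Registered stubs (the ONLY sorries of this file) -/

/-- **S1 · stub_coarseGapCertificate** (open-problem; PROMOTED — the gross-defect regime WITH feasibility).
At the hcp-family minimiser `(a,h)`, `h = (1+t)a√(2/3)`, for every hard core `δ > 0`: there are ONE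
tolerance `η₀ ∈ (0, a/100]` and a threshold radius `R₀` such that at every radius `R ≥ R₀` some
pair-splitting rule is feasible on `δ`-separated configurations and GAPPED at `η₀`: a site with weighted
energy `< e_∞ + c₀` has its first shell `η₀`-close to `S(a,t)`.  It carries the near-field transfers,
the far-field first-order design, feasibility (= crux r2 `FiniteRangeSplitting`, implied: p153831) and
polytype selection (`c₀ ≲ e_fcc − e_hcp ≈ 7.25·10⁻⁵`); with X₂ it implies the Lennard-Jones/hcp energy
identity `e_∞ = e(hcp(a,t))`.  Why it might fail: Lennard-Jones ultimately frustrated at the exact level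
(Miękisz scenario), or hcp(a*,h*) not the ground state.  Sources: Miekisz1998, HolsztynskiSlawny1978,
HalesDSP2012, BlancLewin2015, Stillinger2001. -/
theorem stub_coarseGapCertificate :
    ∀ δ : ℝ, 0 < δ → ∀ a h t : ℝ, 0 < a → |t| ≤ 1 / 100 → h = (1 + t) * a * Real.sqrt (2 / 3) →
      HcpFamilyMin a h → ∃ η₀ : ℝ, 0 < η₀ ∧ η₀ ≤ a / 100 ∧ ∃ R₀ : ℝ, ∀ R : ℝ, R₀ ≤ R →
        ∃ (Φ : E3 → Finset E3 → ℝ) (c₀ : ℝ), IsRule Φ ∧ 0 < c₀ ∧ Feasible δ R Φ ∧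
          ∀ (N : ℕ) (x : Fin N → E3), Sep δ x → ∀ k : Fin N,
            siteE R Φ x k < eInf + c₀ → ShellCloseTo η₀ (shell a x k) (target a t) := by
  sorry

/-! H1 `stub_coreFirstOrderDesign` LANDED (p158539; explicit design, stencil `Y = {u, v, v−u, 2h e₃}`) — imported. -/

/-- **H12⋆ · stub_coreJointCoercive** (XL, certified-numerics-sized; lead holds; reshape r6): at the family minimiser,
the JOINT first+second-order sitewise certificate `CoreJointCoercive a h (1/3) (1/12)` (…CoreJointDefs.lean): a
first-order stencil/table `(Y₁, β)` satisfying H1's identity (the landed line truss of …CoreFirstOrderDesign.lean does: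
`h1_identity`) and second-order covariant decaying tables `(Y₂, M, N)` such that at EVERY site, in the least-squares
co-rotated chart, `κ₁Σ_shell stretch² + κ₃Σ_shell‖Δu − W y‖² + (readout form of β)` ≤ co-rotated naive half-split second
variation + quadratic transfers, for every finitely supported `u`.  Truth = an infinite-dimensional covariant LMI; exact
finite models = tori (FAR-FIELD-ANALYSIS.md §2–3: for the H2⋆ part the κ-demand (1/3,1/12) is not binding at all —
margins at λ = 1 and λ = 0 agree to 3e-7 on 6×6×3 — and the longitudinal far field costs ≈ 0.045 per Σe² (j027807));
the joint form adds the co-rotated prestress (benign: rotations about p become symmetries) and the readout-form demand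
(ℓ¹-mass 1.76 within 3a; numerics j027907/j027933).  What a proof needs: explicit tables (finite rational near part from
the torus SDP ⊕ analytic far families ω_r ~ r⁻⁶…⁻⁷ of cost ≈ 0.05), the two-site reduction (as `coreStarCoercive_of_two_sites`,
to be repeated for the joint form), a finite certificate on near variables and the weighted Hardy–Korn inequality on the
lattice exterior (`stub_farPairLowerBound`, constant 0.04–0.1).  Why it might fail: the readout form of the LANDED β might
cost more than the transfers can supply on some mode — then β is re-optimised jointly (the certificate quantifies ∃β), or
the constants drop (composition generic in κ₁, κ₃, N₀). -/
theorem stub_coreJointCoercive :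
    ∀ a h : ℝ, 0 < a → 0 < h → HcpFamilyMin a h → CoreJointCoercive a h (1 / 3) (1 / 12) := by
  sorry

/-- **H3′ · stub_coreJointAssembly** (XL, item-sized — the quantitative assembly from the JOINT certificate; reshape r6):
`CoreJointAssembly (1/3) (1/12) 100 a h`, i.e. at the family minimiser H12⋆ ⇒ `PerturbativeCore δ a t η₀ e(hcp(a,h))` for
every hard core `δ`, `|t| ≤ 1/100`, `0 < η₀ ≤ a/100`.  Plan (H3-SCOPE.md "what the assembly must do"): per-site LS
co-rotated chart for p's whole ledger; rule `½ + [β·g + M,N·g·g − cubic corrections]/V` with ONE rotation-invariant readout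
g; second order covered by H12⋆ INCLUDING the readout form; first-shell cubic remainder `≤ 0.162Σx² + 0.0015Σy²` at
ρ = 1/100 against `κ₁a²/1.3 = 0.242`, `κ₃/1.3 = 0.064` (52 % used); strictness from κ₃; two-shell-good charts; bad sites via
the composite rule; far-beyond-chart bonds and planar/dislocation defects as in H3-SCOPE Q3.  Why it might fail: an
uncharted all-good configuration (excluded by two-shell rigidity), or far-field/curvature bookkeeping larger than the 30 %
overhead (then N₀ grows). -/
theorem stub_coreJointAssembly : ∀ a h : ℝ, CoreJointAssembly (1 / 3) (1 / 12) 100 a h := by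
  sorry

/-! ## Derived pieces (sorry-free given the stubs) -/

/-- H1 (`stub_coreFirstOrderDesign`, landed p158539) is also the projection of the joint certificate; recorded for the
audit trail of r6 (not used below). -/
theorem coreFirstOrderDesign_of_stub_joint :
    ∀ a h : ℝ, 0 < a → 0 < h → HcpFamilyMin a h → CoreFirstOrderDesign a h :=
  fun a h ha hh hfam => coreFirstOrderDesign_of_joint (stub_coreJointCoercive a h ha hh hfam)

/-- **S2b-core at fraction `1/100`** (r6: anchor `stub_perturbativeCoreOfJointPieces` ∘ (H12⋆, H3′)). -/
theorem stub_perturbativeCore :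
    ∀ δ : ℝ, 0 < δ → ∀ a h t η₀ : ℝ, 0 < a → |t| ≤ 1 / 100 →
      h = (1 + t) * a * Real.sqrt (2 / 3) → HcpFamilyMin a h → ∀ (ha : a ≠ 0) (hh : h ≠ 0),
        0 < η₀ → η₀ ≤ a / 100 →
          PerturbativeCore δ a t η₀ ((hcpPeriodicConfiguration ha hh).energyPerParticle lennardJones) :=
  stub_perturbativeCoreOfJointPieces (1 / 3) (1 / 12) 100 stub_coreJointCoercive stub_coreJointAssembly

/-- **S2b at fraction `1/N₀` from a core at fraction `1/N₀`** (generic in `N₀`; the landed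
`perturbative_certificate_of_core` with `e := e(hcp(a,h))` and `e_∞ ≤ e` = `PeriodicUpperBound`). -/
theorem perturbativeCertificate_of_core (N₀ : ℝ)
    (hcore : ∀ δ : ℝ, 0 < δ → ∀ a h t η₀ : ℝ, 0 < a → |t| ≤ 1 / 100 →
      h = (1 + t) * a * Real.sqrt (2 / 3) → HcpFamilyMin a h → ∀ (ha : a ≠ 0) (hh : h ≠ 0),
        0 < η₀ → η₀ ≤ a / N₀ →
          PerturbativeCore δ a t η₀ ((hcpPeriodicConfiguration ha hh).energyPerParticle lennardJones)) :
    ∀ δ : ℝ, 0 < δ → ∀ a h t η₀ : ℝ, 0 < a → |t| ≤ 1 / 100 → h = (1 + t) * a * Real.sqrt (2 / 3) →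
      HcpFamilyMin a h → 0 < η₀ → η₀ ≤ a / N₀ → ∃ R₀ : ℝ, ∀ R : ℝ, R₀ ≤ R →
        ∃ Φ : E3 → Finset E3 → ℝ, IsRule Φ ∧
          (∀ (N : ℕ) (x : Fin N → E3), Sep δ x → ∀ k : Fin N,
              ShellCloseTo η₀ (shell a x k) (target a t) → eInf ≤ siteE R Φ x k) ∧
          ∀ η : ℝ, 0 < η → ∃ c : ℝ, 0 < c ∧ ∀ (N : ℕ) (x : Fin N → E3), Sep δ x → ∀ k : Fin N,
            ShellCloseTo η₀ (shell a x k) (target a t) → siteE R Φ x k < eInf + c →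
              ShellCloseTo η (shell a x k) (target a t) := by
  intro δ hδ a h t η₀ ha ht hht hmin hη₀ hη₀a
  obtain ⟨ha', hh', hmin'⟩ := hmin
  have hP := periodicUpperBound_proof
  unfold Summit.AtomisticToContinuum.Crystallization.Theses.FreeSplittingCertificates.PeriodicUpperBound
    at hP
  exact perturbative_certificate_of_core hδ (hP _)
    (hcore δ hδ a h t η₀ ha ht hht ⟨ha', hh', hmin'⟩ ha' hh' hη₀ hη₀a)

/-- S2 recomposed from S2a + S2b at fraction `1/N₀` (the deficit constant of S2a serves the rule of S2b). -/
theorem perturbativeCertificate_of (N₀ : ℝ)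
    (h2a : ∀ δ : ℝ, 0 < δ → ∃ D : ℝ, 0 ≤ D ∧ ∀ (R : ℝ) (Φ : E3 → Finset E3 → ℝ),
      IsRule Φ → ∀ (N : ℕ) (x : Fin N → E3), Sep δ x → ∀ k : Fin N, eInf - D ≤ siteE R Φ x k)
    (h2b : ∀ δ : ℝ, 0 < δ → ∀ a h t η₀ : ℝ, 0 < a → |t| ≤ 1 / 100 → h = (1 + t) * a * Real.sqrt (2 / 3) →
      HcpFamilyMin a h → 0 < η₀ → η₀ ≤ a / N₀ → ∃ R₀ : ℝ, ∀ R : ℝ, R₀ ≤ R →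
        ∃ Φ : E3 → Finset E3 → ℝ, IsRule Φ ∧
          (∀ (N : ℕ) (x : Fin N → E3), Sep δ x → ∀ k : Fin N,
              ShellCloseTo η₀ (shell a x k) (target a t) → eInf ≤ siteE R Φ x k) ∧
          ∀ η : ℝ, 0 < η → ∃ c : ℝ, 0 < c ∧ ∀ (N : ℕ) (x : Fin N → E3), Sep δ x → ∀ k : Fin N,
            ShellCloseTo η₀ (shell a x k) (target a t) → siteE R Φ x k < eInf + c →
              ShellCloseTo η (shell a x k) (target a t)) :
    ∀ δ : ℝ, 0 < δ → ∀ a h t η₀ : ℝ, 0 < a → |t| ≤ 1 / 100 → h = (1 + t) * a * Real.sqrt (2 / 3) →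
      HcpFamilyMin a h → 0 < η₀ → η₀ ≤ a / N₀ → ∃ R₀ : ℝ, ∀ R : ℝ, R₀ ≤ R →
        ∃ (Φ : E3 → Finset E3 → ℝ) (D : ℝ), IsRule Φ ∧ 0 ≤ D ∧
          (∀ (N : ℕ) (x : Fin N → E3), Sep δ x → ∀ k : Fin N, eInf - D ≤ siteE R Φ x k) ∧
          (∀ (N : ℕ) (x : Fin N → E3), Sep δ x → ∀ k : Fin N,
              ShellCloseTo η₀ (shell a x k) (target a t) → eInf ≤ siteE R Φ x k) ∧
          ∀ η : ℝ, 0 < η → ∃ c : ℝ, 0 < c ∧ ∀ (N : ℕ) (x : Fin N → E3), Sep δ x → ∀ k : Fin N,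
            ShellCloseTo η₀ (shell a x k) (target a t) → siteE R Φ x k < eInf + c →
              ShellCloseTo η (shell a x k) (target a t) := by
  intro δ hδ a h t η₀ ha ht hht hmin hη₀ hη₀a
  obtain ⟨D, hD, hdef⟩ := h2a δ hδ
  obtain ⟨R₀, hR₀⟩ := h2b δ hδ a h t η₀ ha ht hht hmin hη₀ hη₀a
  refine ⟨R₀, fun R hR => ?_⟩
  obtain ⟨Φ, hrule, hgood, hstrict⟩ := hR₀ R hR
  exact ⟨Φ, D, hrule, hD, fun N x hx k => hdef R Φ hrule N x hx k, hgood, hstrict⟩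

/-! ## The composition (seam `mix`/`isRule_mix`/`siteE_mix` from the Defs file), generic in the fraction `1/N₀` -/

/-- **The composition** (kernel-checked, no `sorry`): S0 → S1(N₀) → S2(N₀) → the crux BY NAME.
Proof: pin `(a,h,t)` by S0; take S1's tolerance `η₀ ≤ a/N₀` and feed it to S2; common radius
`R := max (max R₀¹ R₀²) 1`; mix with `λ := c₀ / (2(c₀ + D))`, so that bad sites keep slack `≥ c₀/2`
(`(1-λ)c₀ − λD = c₀/2`) and good sites inherit `Φ₂`'s non-negativity and strictness with
`c(η) := min (c₀/2) (λ·c₂(η))`. -/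
theorem StrictSplittingRule_of (N₀ : ℝ) :
    (∃ a h t : ℝ, 0 < a ∧ |t| ≤ 1 / 100 ∧ h = (1 + t) * a * Real.sqrt (2 / 3) ∧ HcpFamilyMin a h) →
    (∀ δ : ℝ, 0 < δ → ∀ a h t : ℝ, 0 < a → |t| ≤ 1 / 100 → h = (1 + t) * a * Real.sqrt (2 / 3) →
      HcpFamilyMin a h → ∃ η₀ : ℝ, 0 < η₀ ∧ η₀ ≤ a / N₀ ∧ ∃ R₀ : ℝ, ∀ R : ℝ, R₀ ≤ R →
        ∃ (Φ : E3 → Finset E3 → ℝ) (c₀ : ℝ), IsRule Φ ∧ 0 < c₀ ∧ Feasible δ R Φ ∧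
          ∀ (N : ℕ) (x : Fin N → E3), Sep δ x → ∀ k : Fin N,
            siteE R Φ x k < eInf + c₀ → ShellCloseTo η₀ (shell a x k) (target a t)) →
    (∀ δ : ℝ, 0 < δ → ∀ a h t η₀ : ℝ, 0 < a → |t| ≤ 1 / 100 → h = (1 + t) * a * Real.sqrt (2 / 3) →
      HcpFamilyMin a h → 0 < η₀ → η₀ ≤ a / N₀ → ∃ R₀ : ℝ, ∀ R : ℝ, R₀ ≤ R →
        ∃ (Φ : E3 → Finset E3 → ℝ) (D : ℝ), IsRule Φ ∧ 0 ≤ D ∧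
          (∀ (N : ℕ) (x : Fin N → E3), Sep δ x → ∀ k : Fin N, eInf - D ≤ siteE R Φ x k) ∧
          (∀ (N : ℕ) (x : Fin N → E3), Sep δ x → ∀ k : Fin N,
              ShellCloseTo η₀ (shell a x k) (target a t) → eInf ≤ siteE R Φ x k) ∧
          ∀ η : ℝ, 0 < η → ∃ c : ℝ, 0 < c ∧ ∀ (N : ℕ) (x : Fin N → E3), Sep δ x → ∀ k : Fin N,
            ShellCloseTo η₀ (shell a x k) (target a t) → siteE R Φ x k < eInf + c →
              ShellCloseTo η (shell a x k) (target a t)) →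
    Summit.AtomisticToContinuum.Crystallization.Theses.FreeSplittingCertificates.StrictSplittingRule := by
  intro h0 h1 h2
  rw [strictSplittingRule_iff]
  intro δ hδ
  obtain ⟨a, h, t, ha, ht, hht, hmin⟩ := h0
  obtain ⟨η₀, hη₀, hη₀a, R₁, hR₁⟩ := h1 δ hδ a h t ha ht hht hmin
  obtain ⟨R₂, hR₂⟩ := h2 δ hδ a h t η₀ ha ht hht hmin hη₀ hη₀a
  -- common radius
  set R : ℝ := max (max R₁ R₂) 1 with hRdef
  have hRR₁ : R₁ ≤ R := le_trans (le_max_left _ _) (le_max_left _ _)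
  have hRR₂ : R₂ ≤ R := le_trans (le_max_right _ _) (le_max_left _ _)
  have hRpos : 0 < R := lt_of_lt_of_le one_pos (le_max_right _ _)
  obtain ⟨Φ₁, c₀, hrule₁, hc₀, hfeas₁, hgap₁⟩ := hR₁ R hRR₁
  obtain ⟨Φ₂, D, hrule₂, hD, hdef₂, hgood₂, hstrict₂⟩ := hR₂ R hRR₂
  -- mixing parameter
  have hcD : 0 < c₀ + D := by linarith
  set l : ℝ := c₀ / (2 * (c₀ + D)) with hl
  have hl0 : 0 < l := by positivity
  have hlkey : l * (c₀ + D) = c₀ / 2 := by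
    rw [hl]; field_simp
  have hl1 : l ≤ 1 := by nlinarith [hlkey, hc₀, hD]
  have hl1' : 0 ≤ 1 - l := sub_nonneg.mpr hl1
  refine ⟨R, mix l Φ₁ Φ₂, a, t, hRpos, ha, ht, isRule_mix hl0.le hl1 hrule₁ hrule₂, ?_, ?_⟩
  · -- feasibility of the mixture
    intro N x hx i
    rw [siteE_mix]
    by_cases hgood : ShellCloseTo η₀ (shell a x i) (target a t)
    · have e1 := hfeas₁ N x hx i
      have e2 := hgood₂ N x hx i hgood
      nlinarith [mul_le_mul_of_nonneg_left e1 hl1', mul_le_mul_of_nonneg_left e2 hl0.le]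
    · have e1 : eInf + c₀ ≤ siteE R Φ₁ x i := not_lt.mp fun hh => hgood (hgap₁ N x hx i hh)
      have e2 := hdef₂ N x hx i
      nlinarith [mul_le_mul_of_nonneg_left e1 hl1', mul_le_mul_of_nonneg_left e2 hl0.le, hlkey]
  · -- strictness of the mixture
    intro η hη
    obtain ⟨c₂, hc₂, hstr⟩ := hstrict₂ η hη
    refine ⟨min (c₀ / 2) (l * c₂), lt_min (by linarith) (by positivity), ?_⟩
    intro N x hx k hk
    rw [siteE_mix] at hk
    have hmin1 : min (c₀ / 2) (l * c₂) ≤ c₀ / 2 := min_le_left _ _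
    have hmin2 : min (c₀ / 2) (l * c₂) ≤ l * c₂ := min_le_right _ _
    have hgood : ShellCloseTo η₀ (shell a x k) (target a t) := by
      by_contra hbad
      have e1 : eInf + c₀ ≤ siteE R Φ₁ x k := not_lt.mp fun hh => hbad (hgap₁ N x hx k hh)
      have e2 := hdef₂ N x hx k
      nlinarith [mul_le_mul_of_nonneg_left e1 hl1', mul_le_mul_of_nonneg_left e2 hl0.le, hlkey]
    refine hstr N x hx k hgood ?_
    have e1 := hfeas₁ N x hx k
    have h3 : l * siteE R Φ₂ x k < l * (eInf + c₂) := by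
      nlinarith [mul_le_mul_of_nonneg_left e1 hl1']
    exact lt_of_mul_lt_mul_left h3 hl0.le

/-- The line CLOSES MODULO ITS STUBS: `StrictSplittingRule_of 100` applied to the registered stubs, recomposed
(S0 from S0a+S0b, S1 verbatim, S2 from S2a + (S2b ⇐ core ⇐ H12⋆, H3′)); this declaration inherits the
three stubs' `sorry`s and nothing else. -/
theorem strictSplittingRule_of_stubs :
    Summit.AtomisticToContinuum.Crystallization.Theses.FreeSplittingCertificates.StrictSplittingRule :=
  have _anchor : IsRule (fun _ _ => (1 / 2 : ℝ)) := stub_defs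
  StrictSplittingRule_of 100 (hcpFamilyMinimiser_of stub_hcpFamilyMinExists stub_hcpFamilyMinLocalised)
    stub_coarseGapCertificate
    (perturbativeCertificate_of 100 stub_deficitBound (perturbativeCertificate_of_core 100 stub_perturbativeCore))

end Summit.AtomisticToContinuum.Crystallization.Theorems.StrictSplittingRuleBirth

end
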